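import Mathlib.Analysis.Calculus.DifferentialForm.VectorField
import Literature.Geometry.Kaehler.OneFormDerivativeVectorFields
import HarnessLib

/-!
# The exterior derivative of a `k`-form evaluated on `k + 1` vector fields (manifold case):
# Warner's "invariant formula" 2.25 (f) in every degree, and the degree-two case

Topic `Literature/Geometry/Kaehler` (vocabulary of `ManifoldForms`: `MForm I M F k`, the chart
representative `MForm.inChart`, the exterior derivative `mextDeriv`); continues
`OneFormDerivativeVectorFields` (the degree-one case and its chart lemmas).

**Warner 1983, Prop. 2.25 (f)**: for a smooth `p`-form `ω` and smooth vector fields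
`Y₀, …, Y_p`,

  `dω(Y₀, …, Y_p) = Σ_i (-1)^i Y_i (ω(Y₀, …, Ŷ_i, …, Y_p))
      + Σ_{i<j} (-1)^{i+j} ω([Y_i, Y_j], Y₀, …, Ŷ_i, …, Ŷ_j, …, Y_p)`

(normalisation of `d` as in Mathlib's `extDeriv`, which is Warner's).  Mathlib has the normed-space
identity in every degree (`extDerivWithin_apply_vectorField`, with its own indexing of the double sum:
the pair `(i, j)`, `i ≤ j`, stands for the pair of fields `(V_{i}, V_{j+1})`, which flips the sign in
front of the double sum).  We transport it to manifolds through the extended chart at the point, as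
in the degree-one file: the chart representatives of the fields are Mathlib's `mpullbackWithin` by the
inverse extended chart (as in the definition of `VectorField.mlieBracket`), the functions
`y ↦ ω_y(Y_{i₁} y, …)` read in the chart are the representative `ω.inChart x₀` evaluated on the
representative fields, and at the base point all identifications are the identity.

PROVED (0 named facts): `MForm.apply_vectorFields_eventuallyEq_inChart`,
`MForm.hasMFDerivAt_apply_vectorFields`, `MForm.mvfderiv_apply_vectorFields` (chart lemmas in every
degree); **`mextDeriv_apply_vectorFields`** (2.25 (f) in every degree `k = n + 1 ≥ 1`, Mathlib's
indexing); and the degree-two case written out,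
**`mextDeriv_two_apply_vectorField`**:

  `dω(Y₀, Y₁, Y₂) = Y₀ ω(Y₁, Y₂) - Y₁ ω(Y₀, Y₂) + Y₂ ω(Y₀, Y₁)
      - ω([Y₀, Y₁], Y₂) + ω([Y₀, Y₂], Y₁) - ω([Y₁, Y₂], Y₀)`

(the formula by which `dω` of the symplectic form is computed from a connection, e.g. in the proof
that almost Kähler manifolds are quasi-Kähler).

## References

* F. W. Warner, *Foundations of Differentiable Manifolds and Lie Groups*, GTM 94, Springer (1983),
  Prop. 2.25 (f) (p. 70) and 2.20 (local computation of `d`). [Warner1983]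
-/

noncomputable section

open Set Function Filter VectorField
open scoped Manifold ContDiff Topology

namespace Literature.Geometry.Kaehler

variable {E : Type*} [NormedAddCommGroup E] [NormedSpace ℝ E]
  {H : Type*} [TopologicalSpace H] {I : ModelWithCorners ℝ E H}
  {M : Type*} [TopologicalSpace M] [ChartedSpace H M]
  {F : Type*} [NormedAddCommGroup F] [NormedSpace ℝ F]

/-- Transport of the value of a form along an equality of base points (all tangent spaces are the
model space `E` definitionally). [folklore] -/
private theorem MForm.apply_eq_of_eq_point' {k : ℕ} (α : MForm I M F k) {p q : M} (h : p = q) (w : Fin k → E) :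
    α p w = α q w := by
  subst h
  rfl

/-! ### Chart representatives in every degree -/

section Chart

variable [IsManifold I 2 M]

/-- **The function `y ↦ ω_y(Y₁ y, …, Y_k y)` read in the extended chart at `x₀`**: near `x₀` it is the
chart representative `ω.inChart x₀` evaluated at `extChartAt I x₀ y` on the chart representatives
`mpullbackWithin 𝓘(ℝ, E) I (extChartAt I x₀).symm Y_i (range I)` of the fields. [folklore] -/
theorem MForm.apply_vectorFields_eventuallyEq_inChart {k : ℕ} (α : MForm I M F k) (x₀ : M)
    (Y : Fin k → Π x : M, TangentSpace I x) :
    ∀ᶠ y in 𝓝 x₀, α y (fun i ↦ Y i y) =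
      α.inChart x₀ (extChartAt I x₀ y)
        (fun i ↦ mpullbackWithin 𝓘(ℝ, E) I (extChartAt I x₀).symm (Y i) (range I) (extChartAt I x₀ y)) := by
  filter_upwards [extChartAt_source_mem_nhds (I := I) x₀] with y hy
  have hyt : extChartAt I x₀ y ∈ (extChartAt I x₀).target := (extChartAt I x₀).map_source hy
  have hA := isInvertible_mfderivWithin_extChartAt_symm (I := I) hyt
  rw [MForm.inChart_apply]
  simp only [mpullbackWithin_apply, hA.self_apply_inverse]
  rw [(extChartAt I x₀).left_inv hy]

/-- **The manifold derivative of `y ↦ ω_y(Y₁ y, …, Y_k y)` at `x₀`, in the chart**: if the chart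
representative `ω.inChart x₀` is differentiable within `range I` at the image `z₀` of `x₀` and the
fields are differentiable at `x₀`, then the function has at `x₀` the manifold derivative
`fderivWithin ℝ (z ↦ (ω.inChart x₀ z)(Y'₁ z, …)) (range I) z₀`, `Y'_i` the chart representatives.
[folklore] -/
theorem MForm.hasMFDerivAt_apply_vectorFields [CompleteSpace E] {k : ℕ} {α : MForm I M F k} {x₀ : M}
    (hα : DifferentiableWithinAt ℝ (α.inChart x₀) (range I) (extChartAt I x₀ x₀))
    {Y : Fin k → Π x : M, TangentSpace I x}
    (hY : ∀ i, MDifferentiableAt I (I.prod 𝓘(ℝ, E)) (fun y ↦ (Y i y : TangentBundle I M)) x₀) :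
    HasMFDerivAt I 𝓘(ℝ, F) (fun y ↦ α y (fun i ↦ Y i y)) x₀
      (fderivWithin ℝ (fun z ↦ α.inChart x₀ z
        (fun i ↦ mpullbackWithin 𝓘(ℝ, E) I (extChartAt I x₀).symm (Y i) (range I) z)) (range I)
        (extChartAt I x₀ x₀)) := by
  set φ := extChartAt I x₀ with hφ
  set Y' : Fin k → E → E := fun i ↦ mpullbackWithin 𝓘(ℝ, E) I φ.symm (Y i) (range I) with hY'
  set G : E → F := fun z ↦ α.inChart x₀ z (fun i ↦ Y' i z) with hG
  have hY'd : ∀ i, DifferentiableWithinAt ℝ (Y' i) (range I) (φ x₀) := by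
    intro i
    have h := MDifferentiableWithinAt.differentiableWithinAt_mpullbackWithin_vectorField (I := I)
      (s := univ) (V := Y i) (x := x₀) (mdifferentiableWithinAt_univ.2 (hY i))
    simpa only [preimage_univ, univ_inter] using h
  have hGd : DifferentiableWithinAt ℝ G (range I) (φ x₀) :=
    hα.continuousAlternatingMap_apply (g := fun i ↦ Y' i) fun i ↦ hY'd i
  have hGm : HasMFDerivWithinAt 𝓘(ℝ, E) 𝓘(ℝ, F) G (range I) (φ x₀) (fderivWithin ℝ G (range I) (φ x₀)) :=
    hGd.hasFDerivWithinAt.hasMFDerivWithinAt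
  have hφm : HasMFDerivWithinAt I 𝓘(ℝ, E) φ univ x₀ (ContinuousLinearMap.id ℝ E) := by
    have h := (mdifferentiableAt_extChartAt (I := I) (mem_chart_source H x₀)).hasMFDerivAt
    rw [mfderiv_extChartAt_self] at h
    exact h.hasMFDerivWithinAt
  have hst : (univ : Set M) ⊆ φ ⁻¹' range I := fun y _ ↦ by
    rw [mem_preimage, hφ, extChartAt_coe]
    exact mem_range_self _
  have hcomp := HasMFDerivWithinAt.comp x₀ hGm hφm hst
  rw [hasMFDerivWithinAt_univ] at hcomp
  refine (hcomp.congr_mfderiv ?_).congr_of_eventuallyEq ?_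
  · ext v
    rfl
  · filter_upwards [α.apply_vectorFields_eventuallyEq_inChart x₀ Y] with y hy
    exact hy

/-- `y ↦ ω_y(Y₁ y, …, Y_k y)` is differentiable at `x₀` under the hypotheses of
`MForm.hasMFDerivAt_apply_vectorFields`. [folklore] -/
theorem MForm.mdifferentiableAt_apply_vectorFields [CompleteSpace E] {k : ℕ} {α : MForm I M F k} {x₀ : M}
    (hα : DifferentiableWithinAt ℝ (α.inChart x₀) (range I) (extChartAt I x₀ x₀))
    {Y : Fin k → Π x : M, TangentSpace I x}
    (hY : ∀ i, MDifferentiableAt I (I.prod 𝓘(ℝ, E)) (fun y ↦ (Y i y : TangentBundle I M)) x₀) :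
    MDifferentiableAt I 𝓘(ℝ, F) (fun y ↦ α y (fun i ↦ Y i y)) x₀ :=
  (MForm.hasMFDerivAt_apply_vectorFields hα hY).mdifferentiableAt

/-- The value of `Y (ω(Y₁, …, Y_k))` at `x₀`, read in the chart. [folklore] -/
theorem MForm.mvfderiv_apply_vectorFields [CompleteSpace E] {k : ℕ} {α : MForm I M F k} {x₀ : M}
    (hα : DifferentiableWithinAt ℝ (α.inChart x₀) (range I) (extChartAt I x₀ x₀))
    {Y : Fin k → Π x : M, TangentSpace I x}
    (hY : ∀ i, MDifferentiableAt I (I.prod 𝓘(ℝ, E)) (fun y ↦ (Y i y : TangentBundle I M)) x₀)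
    (v : TangentSpace I x₀) :
    mvfderiv I (fun y ↦ α y (fun i ↦ Y i y)) x₀ v =
      fderivWithin ℝ (fun z ↦ α.inChart x₀ z
        (fun i ↦ mpullbackWithin 𝓘(ℝ, E) I (extChartAt I x₀).symm (Y i) (range I) z)) (range I)
        (extChartAt I x₀ x₀) v := by
  unfold mvfderiv
  rw [(MForm.hasMFDerivAt_apply_vectorFields hα hY).mfderiv]
  rfl

/-- At the base point the chart representative of a form is the form:
`(ω.inChart x₀ z₀) w = ω_{x₀} w`. [folklore] -/
theorem MForm.inChart_apply_base' {k : ℕ} (α : MForm I M F k) (x₀ : M) (w : Fin k → E) :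
    α.inChart x₀ (extChartAt I x₀ x₀) w = α x₀ w := by
  rw [MForm.inChart_apply, mfderivWithin_range_extChartAt_symm]
  exact α.apply_eq_of_eq_point' (extChartAt_to_inv x₀) w

/-! ### Warner's formula 2.25 (f) in every degree -/

/-- **The exterior derivative of a `k`-form on `k + 1` vector fields (Warner 1983, Prop. 2.25 (f)),
every degree `k = n + 1 ≥ 1`**, on a `C²` manifold with complete model space, for a form whose chart
representative at `x₀` is differentiable within `range I` at the image of `x₀` and fields
differentiable at `x₀`; in Mathlib's indexing of the double sum (the pair `(i, j)`, `i ≤ j`, standing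
for the fields `(Y_i, Y_{j+1})`):

  `dω(Y₀, …, Y_{n+1}) = Σ_i (-1)^i Y_i (ω(…, Ŷ_i, …))
      - Σ_{i ≤ j} (-1)^{i+j} ω([Y_i, Y_{j+1}], …, Ŷ_i, …, Ŷ_{j+1}, …)`,

with the tree's `mextDeriv`, Mathlib's `mvfderiv` for the derivatives of the functions
`y ↦ ω_y(…)` and `VectorField.mlieBracket`.  Transported from Mathlib's normed-space identity
`extDerivWithin_apply_vectorField` through the extended chart at `x₀`. [cite: Warner1983, Prop. 2.25(f)] -/
theorem mextDeriv_apply_vectorFields [CompleteSpace E] {n : ℕ} {α : MForm I M F (n + 1)} {x₀ : M}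
    (hα : DifferentiableWithinAt ℝ (α.inChart x₀) (range I) (extChartAt I x₀ x₀))
    {Y : Fin (n + 2) → Π x : M, TangentSpace I x}
    (hY : ∀ i, MDifferentiableAt I (I.prod 𝓘(ℝ, E)) (fun y ↦ (Y i y : TangentBundle I M)) x₀) :
    mextDeriv α x₀ (fun i ↦ Y i x₀) =
      (∑ i, (-1) ^ i.val • mvfderiv I (fun y ↦ α y (i.removeNth (fun l ↦ Y l y))) x₀ (Y i x₀)) -
        ∑ i : Fin (n + 1), ∑ j ≥ i, (-1) ^ (i + j : ℕ) •
          α x₀ (Matrix.vecCons (mlieBracket I (Y i.castSucc) (Y j.succ) x₀)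
            (j.removeNth (i.castSucc.removeNth (fun l ↦ Y l x₀)))) := by
  set φ := extChartAt I x₀ with hφ
  set z₀ : E := φ x₀ with hz₀
  set W : Fin (n + 2) → E → E := fun i ↦ mpullbackWithin 𝓘(ℝ, E) I φ.symm (Y i) (range I) with hW
  set αc := α.inChart x₀ with hαc
  have hU : UniqueDiffWithinAt ℝ (range I) z₀ :=
    I.uniqueDiffOn _ (extChartAt_target_subset_range x₀ (mem_extChartAt_target x₀))
  have hWd : ∀ i, DifferentiableWithinAt ℝ (W i) (range I) z₀ := by
    intro i
    have h := MDifferentiableWithinAt.differentiableWithinAt_mpullbackWithin_vectorField (I := I)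
      (s := univ) (V := Y i) (x := x₀) (mdifferentiableWithinAt_univ.2 (hY i))
    simpa only [preimage_univ, univ_inter] using h
  have hW0 : ∀ i, W i z₀ = Y i x₀ := fun i ↦ mpullbackWithin_extChartAt_symm_apply_self x₀ (Y i)
  -- the left-hand side in the chart
  have hL : mextDeriv α x₀ (fun i ↦ Y i x₀) = extDerivWithin αc (range I) z₀ (fun i ↦ W i z₀) := by
    change (extDerivWithin αc (range I) z₀).compContinuousLinearMap (mfderiv I 𝓘(ℝ, E) φ x₀) (fun i ↦ Y i x₀) = _
    rw [mfderiv_extChartAt_self, ContinuousAlternatingMap.compContinuousLinearMap_apply]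
    congr 1
    funext i
    rw [hW0 i]
    rfl
  -- Mathlib's expansion in the chart
  have hM := extDerivWithin_apply_vectorField (V := W) hα hWd hU
  rw [hL, hM]
  congr 1
  · refine Finset.sum_congr rfl fun i _ ↦ ?_
    congr 1
    rw [hW0 i]
    exact (MForm.mvfderiv_apply_vectorFields hα (Y := fun l ↦ Y (i.succAbove l)) (fun l ↦ hY _) (Y i x₀)).symm
  · refine Finset.sum_congr rfl fun i _ ↦ Finset.sum_congr rfl fun j _ ↦ ?_
    congr 1
    rw [← MForm.inChart_apply_base' α x₀, mlieBracket_eq_lieBracketWithin_mpullbackWithin]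
    congr 1
    funext l
    refine Fin.cases ?_ (fun l' ↦ ?_) l
    · rfl
    · simp only [Matrix.cons_val_succ]
      change W _ z₀ = Y _ x₀
      exact hW0 _

/-! ### The degree-two case written out -/

/-- **The exterior derivative of a `2`-form on three vector fields** (Warner 1983, Prop. 2.25 (f),
`p = 2`):

  `dω(Y₀, Y₁, Y₂) = Y₀ ω(Y₁, Y₂) - Y₁ ω(Y₀, Y₂) + Y₂ ω(Y₀, Y₁)
      - ω([Y₀, Y₁], Y₂) + ω([Y₀, Y₂], Y₁) - ω([Y₁, Y₂], Y₀)`,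

on a `C²` manifold with complete model space, for a `2`-form whose chart representative at `x₀` is
differentiable within `range I` at the image of `x₀` (e.g. a smooth form) and fields differentiable
at `x₀`. [cite: Warner1983, Prop. 2.25(f)] -/
theorem mextDeriv_two_apply_vectorField [CompleteSpace E] {α : MForm I M F 2} {x₀ : M}
    (hα : DifferentiableWithinAt ℝ (α.inChart x₀) (range I) (extChartAt I x₀ x₀))
    {Y₀ Y₁ Y₂ : Π x : M, TangentSpace I x}
    (hY₀ : MDifferentiableAt I (I.prod 𝓘(ℝ, E)) (fun y ↦ (Y₀ y : TangentBundle I M)) x₀)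
    (hY₁ : MDifferentiableAt I (I.prod 𝓘(ℝ, E)) (fun y ↦ (Y₁ y : TangentBundle I M)) x₀)
    (hY₂ : MDifferentiableAt I (I.prod 𝓘(ℝ, E)) (fun y ↦ (Y₂ y : TangentBundle I M)) x₀) :
    mextDeriv α x₀ ![Y₀ x₀, Y₁ x₀, Y₂ x₀] =
      mvfderiv I (fun y ↦ α y ![Y₁ y, Y₂ y]) x₀ (Y₀ x₀)
        - mvfderiv I (fun y ↦ α y ![Y₀ y, Y₂ y]) x₀ (Y₁ x₀)
        + mvfderiv I (fun y ↦ α y ![Y₀ y, Y₁ y]) x₀ (Y₂ x₀)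
        - α x₀ ![mlieBracket I Y₀ Y₁ x₀, Y₂ x₀]
        + α x₀ ![mlieBracket I Y₀ Y₂ x₀, Y₁ x₀]
        - α x₀ ![mlieBracket I Y₁ Y₂ x₀, Y₀ x₀] := by
  set Y : Fin 3 → Π x : M, TangentSpace I x := ![Y₀, Y₁, Y₂] with hYdef
  have hY : ∀ i, MDifferentiableAt I (I.prod 𝓘(ℝ, E)) (fun y ↦ (Y i y : TangentBundle I M)) x₀ := by
    intro i
    fin_cases i
    · exact hY₀
    · exact hY₁
    · exact hY₂
  have h := mextDeriv_apply_vectorFields (n := 1) hα hY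
  have hv : (fun i ↦ Y i x₀) = ![Y₀ x₀, Y₁ x₀, Y₂ x₀] := by
    funext i; fin_cases i <;> rfl
  rw [hv] at h
  rw [h]
  -- expand the sums over `Fin 3` and `Fin 2`
  have hrem : ∀ i : Fin 3, (fun y ↦ α y (i.removeNth fun l ↦ Y l y)) =
      ![fun y ↦ α y ![Y₁ y, Y₂ y], fun y ↦ α y ![Y₀ y, Y₂ y], fun y ↦ α y ![Y₀ y, Y₁ y]] i := by
    intro i
    fin_cases i <;>
    · funext y
      congr 1
      funext l
      fin_cases l <;> rfl
  simp only [Fin.sum_univ_succ, Fin.sum_univ_zero, hrem]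
  -- the inner sums over `j ≥ i`
  have hI0 : Finset.Ici (0 : Fin (1 + 1)) = Finset.univ := by decide
  have hI1 : Finset.Ici ((0 : Fin 1).succ : Fin (1 + 1)) = {(0 : Fin 1).succ} := by decide
  rw [hI0, hI1]
  -- removing entries of explicit vectors
  have hR0 : ∀ {m : ℕ} (a : TangentSpace I x₀) (u : Fin m → TangentSpace I x₀),
      Fin.removeNth 0 (Matrix.vecCons a u) = u := fun a u ↦ by
    funext l
    simp [Fin.removeNth]
  have hRs : ∀ {m : ℕ} (j : Fin (m + 1)) (a : TangentSpace I x₀)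
      (u : Fin (m + 1) → TangentSpace I x₀),
      Fin.removeNth j.succ (Matrix.vecCons a u) = Matrix.vecCons a (Fin.removeNth j u) :=
    fun j a u ↦ by
    funext l
    refine Fin.cases ?_ (fun l ↦ ?_) l <;> simp [Fin.removeNth]
  have hcs : ∀ {m : ℕ} (j : Fin m), (Fin.succ j).castSucc = Fin.succ (Fin.castSucc j) :=
    fun j ↦ rfl
  simp only [Fin.sum_univ_succ, Fin.sum_univ_zero, Finset.sum_singleton, hcs, Fin.castSucc_zero,
    hR0, hRs, hYdef, Matrix.cons_val_zero, Matrix.cons_val_succ, Fin.val_zero, Fin.val_succ,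
    zero_add, add_zero, pow_zero, pow_succ, mul_neg, mul_one, neg_neg, one_smul, neg_smul]
  abel

end Chart

end Literature.Geometry.Kaehler

end
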